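import Literature.Probability.FitznerVanDerHofstad2017.NobleBoundsN1Class00
import HarnessLib

/-!
# Fitzner–van der Hofstad (2017), §6.1 — the class `(a,b) = (≥2,0)` of the bound (6.4) at `N = 1`, PROVED

[FvdH17] = R. Fitzner, R. van der Hofstad, *Mean-field behavior for nearest-neighbor percolation in `d > 10`*,
Electron. J. Probab. **22** (2017), no. 43; extended version arXiv:1506.07977v2, v2 p. 59 (TeX source l.9889–9891
and l.9909–9911):

  "**Case `a ≥ 2`.** We consider the cases `w = 0` and `w ≠ 0` to obtain the bound
  `δ_{w,0} ℙ({0 ←2→ u} ∘ {0 ←2→ u}) + 𝓣_{1,2,1}(u,w,0) ≤ P^{S,2}(u,w)`."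
  "**Case `a ≥ 2, b = 0`.** We note that `t = z ∉ {u, u+e_ι}` and obtain the bound
  `𝓣_{1̲,1,0}(e_ι, t−u, w−u) ≤ Ā^{ι,2,0}(u,w,t,t)`."

## What is proved

`jointWit_cls_2_0` — the instance `(a,b) = (2,0)` of the hypothesis `h2` of
`NobleBoundsN1Classes.nobleXiT_one_le_blocks_of_cls`:

  `J(v−u) · ℙ_p^{⊗2}(jointWit u v w z t x ∩ class (2,0)) ≤ Σ_ι 𝟙{v = u+e_ι} P^{S,2}(u,w) Ā'^{ι,2,0}(u,w,t,z) P^{E,0}(t−x,z−x)`.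

On the class, `w ≠ u` and the bond `(u,w)` is CLOSED on level `0`, so every level-`0` witness of a connection
between `u` and `w` (or, if `w = 0`, between `0` and `u`) misses that bond and has length `≥ 2`
(`NoblePercLettersTransport.mem_openConnGe_two_of_notMem`); `z = t`.  The proof is the three-piece regrouping of
`NobleBoundsN1Class00` with LEFT = `{0 ←2→ u}₀, {0 ←2→ u}₀` (`w = 0`: `𝓓_{2,2}(u)`) resp.
`{0 ←1→ u}₀, {u ←2→ w}₀, {w ←1→ 0}₀` (`w ≠ 0`: `𝓣_{1,2,1}(u,w,0)`), MIDDLE = `{u ←1̲→ u+e_ι}₀ ⊛ {u+e_ι ←1→ t}₁ ⊛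
{t ↔ w}₀` (`𝓣_{1̲,1,0}(e_ι,t−u,w−u)`, the level-`1` witness of `{b̄₀ ↔ t}` being bond-disjoint from level `0`),
RIGHT = `{t↔x}₁, {z↔x}₁`.  Tools: `NobleBoundsN1ClassTools` (grouped BK in three groups, bond absorption, letter
side).  No hypothesis beyond the displayed objects; no numeral; no dimension.
-/

namespace Literature.Probability.FitznerVanDerHofstad2017

open Literature.Barriers.CriticalPhenomena Literature.Probability.Percolation Literature.Probability.LatticeModels
open Literature.Probability.FitznerVanDerHofstad2017.NobleBlocks MeasureTheory
open Literature.Probability.FitznerVanDerHofstad2017.NobleBlocks.LenIdx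
open scoped ENNReal BigOperators

variable {d : ℕ}

/-- Bookkeeping for the class `(2,0)`, sub-case `w = 0`: LEFT `![{0←2→u}₀, {0←2→u}₀]` served by `K₀ 0, K₀ 2`;
MIDDLE `![{u←1̲→v}₀, {v←1→t}₁, {t↔w}₀]` by `{b₀}, K₁ 0, K₀ 3`; RIGHT by `K₁ 2, K₁ 3`.  Pools: level `0` =
`Sum.elim K₀ ![{b₀}]`, repulsive level `1` = `![K₁ 0]`, free level `1` = `![K₁ 2, K₁ 3]`. [folklore] -/
def src20z : Fin 2 ⊕ (Fin 3 ⊕ Fin 2) → (Fin 4 ⊕ Fin 1) ⊕ (Fin 1 ⊕ Fin 2) :=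
  Sum.elim ![Sum.inl (Sum.inl 0), Sum.inl (Sum.inl 2)]
    (Sum.elim ![Sum.inl (Sum.inr 0), Sum.inr (Sum.inl 0), Sum.inl (Sum.inl 3)]
      ![Sum.inr (Sum.inr 0), Sum.inr (Sum.inr 1)])

/-- Bookkeeping for the class `(2,0)`, sub-case `w ≠ 0`: LEFT `![{0←1→u}₀, {u←2→w}₀, {w←1→0}₀]` served by
`K₀ 0, K₀ 2, K₀ 1`; MIDDLE and RIGHT as in `src20z`. [folklore] -/
def src20n : Fin 3 ⊕ (Fin 3 ⊕ Fin 2) → (Fin 4 ⊕ Fin 1) ⊕ (Fin 1 ⊕ Fin 2) :=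
  Sum.elim ![Sum.inl (Sum.inl 0), Sum.inl (Sum.inl 2), Sum.inl (Sum.inl 1)]
    (Sum.elim ![Sum.inl (Sum.inr 0), Sum.inr (Sum.inl 0), Sum.inl (Sum.inl 3)]
      ![Sum.inr (Sum.inr 0), Sum.inr (Sum.inr 1)])

/-- **[FvdH17] §6.1, Case `a ≥ 2, b = 0` of (6.4) at `N = 1`.**
`J(v−u) ℙ_p^{⊗2}(jointWit u v w z t x ∩ class (2,0)) ≤ Σ_ι 𝟙{v = u+e_ι} P^{S,2}(u,w) Ā'^{ι,2,0}(u,w,t,z) P^{E,0}(t−x,z−x)`.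
[cite: FitznerVanDerHofstad2017, §6.1 "Case a ≥ 2" and "Case a ≥ 2, b = 0" (arXiv:1506.07977v2 p. 59)] -/
theorem jointWit_cls_2_0 (p : unitInterval) (x u v w z t : Site d) :
    ENNReal.ofReal (bondJ d p (v - u)) * piPerc d p 2 (jointWit u v w z t x ∩ clsSet u w t z 2 0) ≤
      ∑ ι : Fin d × Bool, (if v = u + stepVec ι then (1 : ℝ≥0∞) else 0) *
        (blockPS (Letters.perc d p) 2 u w * blockAbar' (Letters.perc d p) ι 2 0 u w t z *
          blockPE (Letters.perc d p) 0 (t - x) (z - x)) := by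
  classical
  set F := jointWit u v w z t x ∩ clsSet u w t z 2 0 with hF
  -- the bond factor `J(v - u)`
  by_cases hadj : (zdGraph d).Adj 0 (v - u)
  swap
  · rw [ofReal_bondJ_eq_zero_of_not_adj p hadj, zero_mul]; exact zero_le
  obtain ⟨ι₀, hι₀⟩ := (zdGraph_adj_iff_stepVec 0 (v - u)).1 hadj
  have hv : v = u + stepVec ι₀ := by rw [zero_add] at hι₀; exact sub_eq_iff_eq_add'.1 hι₀
  have huv : u ≠ v := by rintro rfl; rw [sub_self] at hadj; exact hadj.ne rfl
  have he : s(u, v) ∈ (zdGraph d).edgeSet :=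
    (SimpleGraph.mem_edgeSet _).2 ((zdGraph_adj_iff_stepVec u v).2 ⟨ι₀, hv⟩)
  rw [bondJ_def, if_pos hadj]
  -- an empty class contributes nothing; otherwise read off the side conditions
  by_cases hne : F.Nonempty
  swap
  · rw [Set.not_nonempty_iff_eq_empty.1 hne, measure_empty, mul_zero]; exact zero_le
  obtain ⟨ω₀, hjw₀, hcls₀⟩ := hne
  obtain ⟨⟨h0w, -, -, hzv, htu, -, -⟩, -⟩ := (mem_jointWit_iff u v w z t x ω₀).1 hjw₀
  have huw : u ≠ w := ((mem_lineCls_two_iff u w 0 ω₀).1 hcls₀.1).1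
  have hzt : t = z := (mem_lineCls_zero_iff t z 1 ω₀).1 hcls₀.2
  have hu0 : u ≠ 0 := fun h => huw (h.trans (h0w h).symm)
  have htv : t ≠ v := fun h => hzv (hzt ▸ h)
  have hvt : v ≠ t := fun h => htv h.symm
  -- the `ι`-sum is at least its `ι₀` term
  refine le_trans ?_ (term_le_sum_ite ι₀ hv _)
  -- absorb `p` as the open bond `b₀` on level `0`
  have hFm : MeasurableSet F := (measurableSet_jointWit u v w z t x).inter (measurableSet_clsSet u w t z 2 0)
  have habs := ofReal_mul_piPerc_preimage_eraseAt0 p he hFm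
  rw [hF, eraseAt0_preimage_jointWit_inter_clsSet, ← hF] at habs
  rw [habs]
  -- the middle and right line families (common to both sub-cases)
  set AM : Fin 3 → Set (BondConfig (Site d)) := ![event (eq 1) u v, event (ge 1) v t, event (ge 0) t w] with hAM
  set AE : Fin 2 → Set (BondConfig (Site d)) := ![event (ge 0) x t, event (ge 0) x t] with hAE
  set cM : Fin 3 → Fin 2 := ![0, 1, 0] with hcM
  set cE : Fin 2 → Fin 2 := ![1, 1] with hcE
  have hfM : ∀ i, IsFinitary (AM i) := fun i => by
    rw [hAM]; fin_cases i
    exacts [isFinitary_event (eq 1) u v, isFinitary_event (ge 1) v t, isFinitary_event (ge 0) t w]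
  have hfE : ∀ i, IsFinitary (AE i) := fun i => by
    rw [hAE]; fin_cases i; exacts [isFinitary_event (ge 0) x t, isFinitary_event (ge 0) x t]
  have hM : piPerc d p 2 (genDisjOcc AM cM) ≤ blockAbar' (Letters.perc d p) ι₀ 2 0 u w t z :=
    piPerc_mid_two_zero_le_blockAbar' p hv hzt.symm cM
  have hE : piPerc d p 2 (genDisjOcc AE cE) ≤ blockPE (Letters.perc d p) 0 (t - x) (z - x) :=
    piPerc_end_zero_le_blockPE p hzt.symm cE rfl
  -- the witnesses of a point of `{b₀ open} ∩ F`, with the facts both sub-cases use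
  have hwit : ∀ ω ∈ {ω : Fin 2 → BondConfig (Site d) | s(u, v) ∈ ω 0} ∩ F,
      ∃ K₀ K₁ : Fin 4 → Set (Sym2 (Site d)),
        (∀ j, K₀ j ⊆ ω 0) ∧ (∀ j, K₁ j ⊆ ω 1) ∧
        (Pairwise fun a a' => Disjoint (Sum.elim K₀ ![({s(u, v)} : Set (Sym2 (Site d)))] a)
          (Sum.elim K₀ ![{s(u, v)}] a')) ∧
        (Pairwise fun i j => Disjoint (K₁ i) (K₁ j)) ∧ (∀ j, Disjoint (K₀ j) (K₁ 0)) ∧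
        Disjoint ({s(u, v)} : Set (Sym2 (Site d))) (K₁ 0) ∧ s(u, v) ∈ ω 0 ∧
        K₀ 0 ∈ (openConn 0 u : Set (BondConfig (Site d))) ∧ K₀ 1 ∈ (openConn 0 w : Set (BondConfig (Site d))) ∧
        K₀ 2 ∈ (openConn w u : Set (BondConfig (Site d))) ∧ K₀ 3 ∈ (openConn t w : Set (BondConfig (Site d))) ∧
        K₁ 0 ∈ (openConn v t : Set (BondConfig (Site d))) ∧ K₁ 2 ∈ (openConn x t : Set (BondConfig (Site d))) ∧
        K₁ 3 ∈ (openConn x t : Set (BondConfig (Site d))) ∧ (∀ j, s(u, w) ∉ K₀ j) := by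
    rintro ω ⟨hb0, hjw, hcls⟩
    obtain ⟨-, K₀, K₁, h₀, h₁, hA₀, hA₁, hd₀, hd₁, hc₀, -, -⟩ := (mem_jointWit_iff u v w z t x ω).1 hjw
    have hclosed : s(u, w) ∉ ω 0 := ((mem_lineCls_two_iff u w 0 ω).1 hcls.1).2
    have hK₀ω : ∀ j, K₀ j ⊆ ω 0 := fun j => (h₀ j).trans (offBonds_subset _ _)
    have hK₁ω : ∀ j, K₁ j ⊆ ω 1 := fun j => (h₁ j).trans (offBonds_subset _ _)
    have hb₀K₀ : ∀ j, Disjoint (K₀ j) {s(u, v)} := fun j => Set.disjoint_singleton_right.2 fun h => by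
      have h' := h₀ j h; rw [offBonds_def] at h'; exact h'.2 rfl
    have hb₀K₁ : Disjoint ({s(u, v)} : Set (Sym2 (Site d))) (K₁ 0) :=
      Set.disjoint_singleton_left.2 fun h => by
        have h' := h₁ 0 h; rw [offBonds_def] at h'
        exact h'.2 ((mem_bondsAt_singleton_iff u _).2 (Sym2.mem_mk_left u v))
    have hK03 : K₀ 3 ∈ (openConn w z : Set (BondConfig (Site d))) := hA₀ 3
    have hK12 : K₁ 2 ∈ (openConn t x : Set (BondConfig (Site d))) := hA₁ 2
    have hK13 : K₁ 3 ∈ (openConn z x : Set (BondConfig (Site d))) := hA₁ 3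
    refine ⟨K₀, K₁, hK₀ω, hK₁ω, pairwise_disjoint_pool₀ hd₀ hb₀K₀, hd₁, fun j => (hc₀ j).symm, hb₀K₁, hb0,
      hA₀ 0, hA₀ 1, hA₀ 2, ?_, hA₁ 0, SimpleGraph.Reachable.symm hK12, ?_, fun j h => hclosed (hK₀ω j h)⟩
    · rw [← hzt] at hK03; exact SimpleGraph.Reachable.symm hK03
    · rw [← hzt] at hK13; exact SimpleGraph.Reachable.symm hK13
  -- the two sub-cases `w = 0` / `w ≠ 0` of the left triangle
  rcases eq_or_ne w 0 with hw0 | hw0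
  · -- `w = 0`: LEFT = `{0 ←2→ u}₀ ∘ {0 ←2→ u}₀ ≤ 𝓓_{2,2}(u)`
    set AS : Fin 2 → Set (BondConfig (Site d)) := ![event (ge 2) 0 u, event (ge 2) 0 u] with hAS
    set cS : Fin 2 → Fin 2 := ![0, 0] with hcS
    have hfS : ∀ i, IsFinitary (AS i) := fun i => by
      rw [hAS]; fin_cases i; exacts [isFinitary_event (ge 2) 0 u, isFinitary_event (ge 2) 0 u]
    have hS : piPerc d p 2 (genDisjOcc AS cS) ≤ blockPS (Letters.perc d p) 2 u w := by
      rw [hw0]; exact piPerc_start_two_zero_le_blockPS p hu0 cS rfl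
    have hincl : {ω : Fin 2 → BondConfig (Site d) | s(u, v) ∈ ω 0} ∩ F ⊆
        genDisjOccGrouped (Sum.elim AS (Sum.elim AM AE)) (Sum.elim cS (Sum.elim cM cE)) tag3 := by
      intro ω hω
      obtain ⟨K₀, K₁, hK₀ω, hK₁ω, hPd, hd₁, hc₀, hb₀K₁, hb0, hK00, -, hK02, hK03, hK10, hK12, hK13, huwK⟩ :=
        hwit ω hω
      have h0u : ∀ j, s(0, u) ∉ K₀ j := fun j => by rw [Sym2.eq_swap, ← hw0]; exact huwK j
      refine mem_genDisjOccGrouped_of_pools₃ _ _ _ ω (Sum.elim K₀ ![({s(u, v)} : Set (Sym2 (Site d)))])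
        ![K₁ 0] ![K₁ 2, K₁ 3] ?_ ?_ ?_ hPd ?_ ?_ src20z (by decide) (by decide) ?_ (by decide)
      · rintro (a | a)
        · exact hK₀ω a
        · fin_cases a; exact Set.singleton_subset_iff.2 hb0
      · intro b; fin_cases b; exact hK₁ω 0
      · intro r; fin_cases r
        · exact hK₁ω 2
        · exact hK₁ω 3
      · rintro (b | b) (b' | b') hbb' <;> fin_cases b <;> fin_cases b' <;> simp at hbb' ⊢ <;> exact hd₁ (by decide)
      · rintro (a | a) b <;> fin_cases b
        · exact hc₀ a
        · fin_cases a; exact hb₀K₁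
      · rintro (i | i | i) <;> fin_cases i
        · show K₀ 0 ∈ (event (ge 2) 0 u : Set (BondConfig (Site d)))
          rw [event_ge]; exact mem_openConnGe_two_of_notMem hK00 hu0.symm (h0u 0)
        · show K₀ 2 ∈ (event (ge 2) 0 u : Set (BondConfig (Site d)))
          rw [event_ge]; rw [hw0] at hK02; exact mem_openConnGe_two_of_notMem hK02 hu0.symm (h0u 2)
        · show ({s(u, v)} : Set (Sym2 (Site d))) ∈ (event (eq 1) u v : Set (BondConfig (Site d)))
          rw [event_eq]; exact mem_openConnEq_one_of_mem huv (Set.mem_singleton _)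
        · show K₁ 0 ∈ (event (ge 1) v t : Set (BondConfig (Site d)))
          rw [event_ge, openConnGe_one_eq hvt]; exact hK10
        · show K₀ 3 ∈ (event (ge 0) t w : Set (BondConfig (Site d)))
          rw [event_ge, openConnGe_zero]; exact hK03
        · show K₁ 2 ∈ (event (ge 0) x t : Set (BondConfig (Site d)))
          rw [event_ge, openConnGe_zero]; exact hK12
        · show K₁ 3 ∈ (event (ge 0) x t : Set (BondConfig (Site d)))
          rw [event_ge, openConnGe_zero]; exact hK13
    calc piPerc d p 2 ({ω : Fin 2 → BondConfig (Site d) | s(u, v) ∈ ω 0} ∩ F)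
        ≤ piPerc d p 2 (genDisjOccGrouped (Sum.elim AS (Sum.elim AM AE)) (Sum.elim cS (Sum.elim cM cE)) tag3) :=
          measure_mono hincl
      _ ≤ piPerc d p 2 (genDisjOcc AS cS) * piPerc d p 2 (genDisjOcc AM cM) * piPerc d p 2 (genDisjOcc AE cE) :=
          piPerc_genDisjOccGrouped_tag3_le p AS AM AE cS cM cE hfS hfM hfE
      _ ≤ _ := mul_le_mul' (mul_le_mul' hS hM) hE
  · -- `w ≠ 0`: LEFT = `{0 ←1→ u}₀ ⊛ {u ←2→ w}₀ ⊛ {w ←1→ 0}₀ ≤ 𝓣_{1,2,1}(u,w,0)`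
    set AS : Fin 3 → Set (BondConfig (Site d)) := ![event (ge 1) 0 u, event (ge 2) u w, event (ge 1) w 0] with hAS
    set cS : Fin 3 → Fin 2 := ![0, 0, 0] with hcS
    have hfS : ∀ i, IsFinitary (AS i) := fun i => by
      rw [hAS]; fin_cases i
      exacts [isFinitary_event (ge 1) 0 u, isFinitary_event (ge 2) u w, isFinitary_event (ge 1) w 0]
    have hS : piPerc d p 2 (genDisjOcc AS cS) ≤ blockPS (Letters.perc d p) 2 u w :=
      piPerc_start_two_ne_le_blockPS p hu0 hw0 cS
    have hincl : {ω : Fin 2 → BondConfig (Site d) | s(u, v) ∈ ω 0} ∩ F ⊆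
        genDisjOccGrouped (Sum.elim AS (Sum.elim AM AE)) (Sum.elim cS (Sum.elim cM cE)) tag3 := by
      intro ω hω
      obtain ⟨K₀, K₁, hK₀ω, hK₁ω, hPd, hd₁, hc₀, hb₀K₁, hb0, hK00, hK01, hK02, hK03, hK10, hK12, hK13, huwK⟩ :=
        hwit ω hω
      refine mem_genDisjOccGrouped_of_pools₃ _ _ _ ω (Sum.elim K₀ ![({s(u, v)} : Set (Sym2 (Site d)))])
        ![K₁ 0] ![K₁ 2, K₁ 3] ?_ ?_ ?_ hPd ?_ ?_ src20n (by decide) (by decide) ?_ (by decide)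
      · rintro (a | a)
        · exact hK₀ω a
        · fin_cases a; exact Set.singleton_subset_iff.2 hb0
      · intro b; fin_cases b; exact hK₁ω 0
      · intro r; fin_cases r
        · exact hK₁ω 2
        · exact hK₁ω 3
      · rintro (b | b) (b' | b') hbb' <;> fin_cases b <;> fin_cases b' <;> simp at hbb' ⊢ <;> exact hd₁ (by decide)
      · rintro (a | a) b <;> fin_cases b
        · exact hc₀ a
        · fin_cases a; exact hb₀K₁
      · rintro (i | i | i) <;> fin_cases i
        · show K₀ 0 ∈ (event (ge 1) 0 u : Set (BondConfig (Site d)))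
          rw [event_ge, openConnGe_one_eq hu0.symm]; exact hK00
        · show K₀ 2 ∈ (event (ge 2) u w : Set (BondConfig (Site d)))
          rw [event_ge]; exact mem_openConnGe_two_of_notMem (SimpleGraph.Reachable.symm hK02) huw (huwK 2)
        · show K₀ 1 ∈ (event (ge 1) w 0 : Set (BondConfig (Site d)))
          rw [event_ge, openConnGe_one_eq hw0]; exact SimpleGraph.Reachable.symm hK01
        · show ({s(u, v)} : Set (Sym2 (Site d))) ∈ (event (eq 1) u v : Set (BondConfig (Site d)))
          rw [event_eq]; exact mem_openConnEq_one_of_mem huv (Set.mem_singleton _)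
        · show K₁ 0 ∈ (event (ge 1) v t : Set (BondConfig (Site d)))
          rw [event_ge, openConnGe_one_eq hvt]; exact hK10
        · show K₀ 3 ∈ (event (ge 0) t w : Set (BondConfig (Site d)))
          rw [event_ge, openConnGe_zero]; exact hK03
        · show K₁ 2 ∈ (event (ge 0) x t : Set (BondConfig (Site d)))
          rw [event_ge, openConnGe_zero]; exact hK12
        · show K₁ 3 ∈ (event (ge 0) x t : Set (BondConfig (Site d)))
          rw [event_ge, openConnGe_zero]; exact hK13
    calc piPerc d p 2 ({ω : Fin 2 → BondConfig (Site d) | s(u, v) ∈ ω 0} ∩ F)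
        ≤ piPerc d p 2 (genDisjOccGrouped (Sum.elim AS (Sum.elim AM AE)) (Sum.elim cS (Sum.elim cM cE)) tag3) :=
          measure_mono hincl
      _ ≤ piPerc d p 2 (genDisjOcc AS cS) * piPerc d p 2 (genDisjOcc AM cM) * piPerc d p 2 (genDisjOcc AE cE) :=
          piPerc_genDisjOccGrouped_tag3_le p AS AM AE cS cM cE hfS hfM hfE
      _ ≤ _ := mul_le_mul' (mul_le_mul' hS hM) hE

end Literature.Probability.FitznerVanDerHofstad2017
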